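import Literature.NumberTheory.Rogawski1990.ArchEPAssemblyDefiniteSlots         -- ★ (12′) E2a p852058: `sum_partnerPerms_chartOrbG_eq_card_mul_sum_restrict` (the `6^{#D}` collapse); brings ★ FILE P
import Literature.NumberTheory.Rogawski1990.ArchChartOrbGIsolateFinset          -- ★ (F′) :242 `chartOrbG_eq_prod_mul_integral_pi_group_isolate_of_forall_not_mem` + §0 `pi_quotientMeasure_eq_prod_inv_smul_map_pi`; brings ★ (A1)
import HarnessLib

/-!
# EP ASSEMBLY, DEFINITE PLACES II′: the `α`-side partner sum in closed form WITH THE `D`-GROUP INTEGRAL INSIDE (Fubini swap of E2b) —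
# `6^{#D}` times the partner sum over the indefinite block of the `I`-quotient integral of the `U(3)^D`-AVERAGE `Ā_{a′}` (N8-INNER ROAD B, brick (12′) E2b, ask (B2′) of E3's census; Folland §2.6, Rogawski 1990 §8.2–8.3)

Topic `NumberTheory/Rogawski1990`; namespaces `Literature.MeasureTheory.Group` (§0, generic: the product of quotient maps), `Literature.NumberTheory.Automorphic.UnitaryGroup` (§1, the swap
of ★ :242) and `Literature.NumberTheory.Rogawski1990` (§2, the swap of E2b).
THEOREMS ONLY (no `def`, no instance, no notation, no axiom, no named fact, no `sorry`).  Cell `pub/hodgecm-mathlib`, crux H413 (`stmt-HodgeConjecture-24833`), F0∕P3c road «N8-INNER» ROAD B,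
brick (12′) «EP ASSEMBLY», ask (B2′) of CENSUS E3 v1 (`F0/P3c/LH3/LH3-p04/g7/e3/CENSUS-E3.v1.LH3p04g7.md` §2, §3 (B2), §5; E3 holder LH3-p04 (g7)): «export E2b ALSO with the `D`-integral INSIDE,
or a named Fubini corollary».  Seat LH3-p03 (g8).  Count-neutral.

THE MATHEMATICS.  Notation of ★ :242 `chartOrbG_eq_prod_mul_integral_pi_group_isolate_of_forall_not_mem` and of E2b: `G′_∞ = U(diag α)(L⁺ ⊗ ℝ) ≃ Π_w U(α)_w` in PRODUCT-MEASURE form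
(`ν′ = e⁻¹⁎ ⊗_w ν′_w`), `S′` admissible, `p` a block of COMPACT-chart places (`p w → w ∉ S′`; for E2b: `α`-DEFINITE places), `c ∈ RegG S′`, `a′ ∈ C_c(G′_∞)`.  ★ :242 reads
`chartOrbG ν′ S′ a′ c = (Π_{¬p} t_w(B′_w)) · ∫_{g ∈ Π_{p} U(α)_w} ∫_{ḃ ∈ Π_{¬p} (U_w ⧸ T′_w)} a′ (e⁻¹ ((g_w γ_w(c) g_w⁻¹)_{p}, (ḃ_w γ_w(c) ḃ_w⁻¹)_{¬p}))` — `D`-group integral OUTSIDE.  E3's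
per-ball identity (census E3 §2 (1)) wants the `U(3)^D`-AVERAGE `Ā_{a′}(x_D, ·) = ∫_{Π_p U(α)_w} a′ (e⁻¹ ((g_w x_w g_w⁻¹)_p, ·)) d(⊗_p ν′_w)(g)` INSIDE the `I`-quotient integral.  This file is
exactly that Fubini swap, in three heads:
* §1 **`integrable_prod_pi_group_quotient_isolate_of_forall_not_mem`** — the two-variable integrand `(g, ḃ) ↦ a′ (e⁻¹ ((g_w γ_w(c) g_w⁻¹)_p, (ḃ_w γ_w(c) ḃ_w⁻¹)_{¬p}))` is INTEGRABLE
  against `(⊗_p ν′_w) ⊗ (⊗_{¬p} ν′_w ∕ t_w)`.  Proof = transport of ★ (A1) `integrable_comp_symm_archPiEquivCM_descConj_pi_of_regG` (integrability on `Π_w (U_w ⧸ T′_w)`, the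
  uniformly-proper chart at a regular point) along the index split `piEquivPiSubtypeProd … p` (★ (A1) `measurePreserving_piEquivPiSubtypeProd'`) and along the product of
  the quotient maps on the `p`-block, whose image measure is `(Π_p t_w(T′_w)) • ⊗_p (ν′_w ∕ t_w)` for COMPACT `T′_w` (★ `pi_quotientMeasure_eq_prod_inv_smul_map_pi`, solved for the image in §0 `map_pi_quotientMk_eq_prod_smul_pi_quotientMeasure`); Mathlib
  `Measure.map_prod_map`, `Measure.prod_smul_left`, `integrable_map_measure`.
* §1 **`chartOrbG_eq_prod_mul_integral_quotient_integral_group_isolate_of_forall_not_mem`** — ★ :242 with the order of integration SWAPPED: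
  `chartOrbG ν′ S′ a′ c = (Π_{¬p} t_w(B′_w)) · ∫_{ḃ ∈ Π_{¬p} (U_w ⧸ T′_w)} ( ∫_{g ∈ Π_p U(α)_w} a′ (e⁻¹ ((g_w γ_w(c) g_w⁻¹)_p, (ḃ_w γ_w(c) ḃ_w⁻¹)_{¬p})) d⊗_p ν′_w ) d⊗_{¬p}(ν′_w ∕ t_w)`
  (Mathlib `integral_integral_swap` on §1's integrability).
* §2 **`sum_partnerPerms_chartOrbG_eq_card_mul_sum_integral_quotient_integral_group`** — E2b `sum_partnerPerms_chartOrbG_eq_card_mul_sum_integral_pi_group` with the same swap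
  inside every partner term: `Σ_{ρ ∈ partnerPerms S′} chartOrbG ν′ S′ a′ (ρ·c) = 6^{#p} · Σ_{ρ₂ ∈ partnerPerms S′|_{¬p}} (Π_{¬p} t_w(B′_w)) · ∫_{Π_{¬p} (U_w ⧸ T′_w)} ∫_{Π_p U(α)_w} a′ (…ρ′c…)`,
  `ρ′ = 1 ⊔ ρ₂` (E2a's `6^{#D}` collapse ★ `sum_partnerPerms_chartOrbG_eq_card_mul_sum_restrict`, then §1 at the regular partner point, ★ `slotPerm_mem_regG_iff` at the glued
  relabelling `1 ⊔ ρ₂`, cf. E2b `piEquivPiSubtypeProd_symm_one_mem_partnerPerms`).  Independent of E2b's file (same imports), so E3a may import either or both.  This is census E3 §2 (1)'s «E2b ⇒ `6^{#D} Σ_{ρ₂ ∈ partnerPerms S|_I} (I-box) ∫_{I-quot} Ā(γ_D(c), (ḃ γ_I(ρ₂c) ḃ⁻¹))` (after the swap)».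
HONEST LABEL: HC_CM is proved only modulo the 7 printed citations (2 remaining: hLiu418 = `stmt-HodgeConjecture-24832`, h413 = `stmt-HodgeConjecture-24833`) until rung 0 closes; count-neutral
measure-theoretic bookkeeping — nothing here closes an organ.

## References
* [Folland1995] G. B. Folland, *A Course in Abstract Harmonic Analysis* (1995), §2.2 (product measures, Fubini–Tonelli), §2.6 Thm. 2.49, (2.52) (quotient integral formula).
* [Rogawski1990] J. D. Rogawski, *Automorphic Representations of Unitary Groups in Three Variables*, Ann. of Math. Stud. 123 (1990), §4.1 (4.1.1) p. 39, §8.2 p. 122, §8.3 p. 124.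
* [Shelstad1979] D. Shelstad, *Characters and inner forms of a quasi-split group over ℝ*, Compositio Math. 39 (1979), §4 p. 22, Lemma 4.2 p. 23.
* [DeitmarEchterhoff2014] A. Deitmar, S. Echterhoff, *Principles of Harmonic Analysis*, 2nd ed. (2014), Cor. 1.5.4, Lemma 9.3.3.
* [BorelJacquet1979] A. Borel, H. Jacquet, *Automorphic forms and automorphic representations*, PSPM 33.1 (1979), §4.1.
-/

set_option autoImplicit false

noncomputable section

open MeasureTheory MeasureTheory.Measure NumberField NumberField.InfinitePlace Matrix Complex Topology
open Literature.MeasureTheory.Group Literature.NumberTheory.Rogawski1990 Literature.NumberTheory.Automorphic Literature.NumberTheory.Automorphic.UnitaryGroup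
  Literature.NumberTheory.Automorphic.ArchCartan
open scoped MatrixGroups Matrix Classical ENNReal NNReal

namespace Literature.MeasureTheory.Group

/-! ## §0 (generic) The product of the quotient maps: measurability, and its image of the product Haar measure for COMPACT subgroups -/

section PiQuotientMk

variable {ι : Type*} {G : ι → Type*} [∀ i, Group (G i)] [∀ i, TopologicalSpace (G i)] [∀ i, MeasurableSpace (G i)] [∀ i, BorelSpace (G i)]
  (K : ∀ i, Subgroup (G i)) [∀ i, MeasurableSpace (G i ⧸ K i)] [∀ i, BorelSpace (G i ⧸ K i)]

/-- The product `(g_i)_i ↦ (g_i K_i)_i` of the quotient maps is Borel (coordinatewise ★ Mathlib `QuotientGroup.continuous_mk`; the device inside ★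
`pi_quotientMeasure_eq_prod_inv_smul_map_pi`, exported). [cite: Folland1995, §2.2] -/
theorem measurable_pi_quotientMk : Measurable (fun g : (∀ i, G i) => fun i => (QuotientGroup.mk (g i) : G i ⧸ K i)) :=
  measurable_pi_iff.mpr fun i => QuotientGroup.continuous_mk.measurable.comp (measurable_pi_apply i)

end PiQuotientMk

section PiCompactMap

variable {ι : Type*} [Fintype ι] {G : ι → Type*} [∀ i, Group (G i)] [∀ i, TopologicalSpace (G i)]
  [∀ i, IsTopologicalGroup (G i)] [∀ i, LocallyCompactSpace (G i)] [∀ i, SecondCountableTopology (G i)] [∀ i, T2Space (G i)]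
  [∀ i, MeasurableSpace (G i)] [∀ i, BorelSpace (G i)]
  (K : ∀ i, Subgroup (G i)) (hK : ∀ i, IsClosed (K i : Set (G i))) [∀ i, CompactSpace ↥(K i)]
  (t : ∀ i, Measure ↥(K i)) [∀ i, (t i).IsMulLeftInvariant] [∀ i, IsFiniteMeasureOnCompacts (t i)] [∀ i, (t i).IsOpenPosMeasure]
  [∀ i, SFinite (t i)] [∀ i, (t i).IsInvInvariant]
  (ν : ∀ i, Measure (G i)) [∀ i, (ν i).IsHaarMeasure] [∀ i, (ν i).IsMulRightInvariant]
  [∀ i, MeasurableSpace (G i ⧸ K i)] [∀ i, BorelSpace (G i ⧸ K i)]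

/-- **`(π_i)_i⁎ ⊗_i ν_i = (Π_i t_i(K_i)) • ⊗_i μ_{G_i/K_i}` FOR COMPACT `K_i`**: the image of the product Haar measure under the product of the quotient maps is the product
of the invariant quotient measures scaled by the (finite, nonzero) product of the total masses — ★ `pi_quotientMeasure_eq_prod_inv_smul_map_pi` solved for the image measure.
[cite: Folland1995, §2.2; §2.6 Thm. 2.49 and (2.52)] [cite: DeitmarEchterhoff2014, Cor. 1.5.4] -/
theorem map_pi_quotientMk_eq_prod_smul_pi_quotientMeasure :
    Measure.map (fun g : (∀ i, G i) => fun i => (QuotientGroup.mk (g i) : G i ⧸ K i)) (Measure.pi ν) =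
      (∏ i, t i Set.univ) • Measure.pi (fun i => quotientMeasure (K i) (t i) (hK i) (ν i)) := by
  have hmass : ∀ i, t i Set.univ ≠ 0 ∧ t i Set.univ ≠ ∞ := fun i =>
    ⟨(isOpen_univ.measure_pos (t i) Set.univ_nonempty).ne', (isCompact_univ.measure_lt_top).ne⟩
  rw [pi_quotientMeasure_eq_prod_inv_smul_map_pi K hK t ν, smul_smul, ← Finset.prod_mul_distrib,
    Finset.prod_eq_one (fun i _ => ENNReal.mul_inv_cancel (hmass i).1 (hmass i).2), one_smul]

end PiCompactMap

end Literature.MeasureTheory.Group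

namespace Literature.NumberTheory.Automorphic.UnitaryGroup

section IsolateSwap

variable (L : Type) [Field L] [NumberField L] [IsCMField L] (α : Fin 3 → L) (S' : Finset {w : InfinitePlace L // IsComplex w})
  [∀ w : {w : InfinitePlace L // IsComplex w}, MeasurableSpace ↥(archLocal L 3 (Matrix.diagonal α) w)]
  [∀ w : {w : InfinitePlace L // IsComplex w}, BorelSpace ↥(archLocal L 3 (Matrix.diagonal α) w)]
  -- ★ `locallyCompactSpace_archLocal_three` ∕ ★ `secondCountableTopology_archLocal_three` (theorems, not instances: supplied by the consumer with `haveI`)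
  [∀ w : {w : InfinitePlace L // IsComplex w}, LocallyCompactSpace ↥(archLocal L 3 (Matrix.diagonal α) w)]
  [∀ w : {w : InfinitePlace L // IsComplex w}, SecondCountableTopology ↥(archLocal L 3 (Matrix.diagonal α) w)]
  [MeasurableSpace ↥(arch (↥(maximalRealSubfield L)) L (IsCMField.complexConj L) 3 (Matrix.diagonal α))]
  [BorelSpace ↥(arch (↥(maximalRealSubfield L)) L (IsCMField.complexConj L) 3 (Matrix.diagonal α))]
  [∀ w : {w : InfinitePlace L // IsComplex w}, MeasurableSpace (↥(archLocal L 3 (Matrix.diagonal α) w) ⧸ chartTorusGLoc L α w S')]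
  [∀ w : {w : InfinitePlace L // IsComplex w}, BorelSpace (↥(archLocal L 3 (Matrix.diagonal α) w) ⧸ chartTorusGLoc L α w S')]
  (ν'w : ∀ w : {w : InfinitePlace L // IsComplex w}, Measure ↥(archLocal L 3 (Matrix.diagonal α) w)) [∀ w, (ν'w w).IsHaarMeasure] [∀ w, (ν'w w).IsMulRightInvariant]
  (ν' : Measure ↥(arch (↥(maximalRealSubfield L)) L (IsCMField.complexConj L) 3 (Matrix.diagonal α))) [ν'.IsHaarMeasure] [ν'.IsMulRightInvariant]
  (hν : ν' = (Measure.pi ν'w).map (archPiEquivCM 3 L (Matrix.diagonal α)).symm)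
  (t : ∀ w : {w : InfinitePlace L // IsComplex w}, Measure ↥(chartTorusGLoc L α w S')) [∀ w, (t w).IsHaarMeasure] [∀ w, (t w).IsInvInvariant]
  -- the isolated places: ANY decidable predicate; the `Fintype` instances of the two index subtypes are BINDERS (★ :242's convention)
  (p : {w : InfinitePlace L // IsComplex w} → Prop) [DecidablePred p]
  [Fintype {w : {w : InfinitePlace L // IsComplex w} // p w}] [Fintype {w : {w : InfinitePlace L // IsComplex w} // ¬ p w}]

include hν in
/-- **INTEGRABILITY OF THE TWO-BLOCK INTEGRAND** `(g, ḃ) ↦ a′ (e⁻¹ ((g_w γ_w(c) g_w⁻¹)_{p}, (ḃ_w γ_w(c) ḃ_w⁻¹)_{¬p}))` against `(⊗_{p} ν′_w) ⊗ (⊗_{¬p} ν′_w ∕ t_w)`, for admissible `S′`, a block `p` of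
COMPACT-chart places (`p w → w ∉ S′`), `c ∈ RegG S′` and `a′ ∈ C_c(G′_∞)`: ★ (A1) integrability on `Π_w (U_w ⧸ T′_w)` transported along the index split and along the product of the
quotient maps on the `p`-block (image measure `(Π_p t_w(T′_w)) • ⊗_p (ν′_w ∕ t_w)`, ★ `pi_quotientMeasure_eq_prod_inv_smul_map_pi`).
[cite: Folland1995, §2.2; §2.6 (2.52)] [cite: Rogawski1990, §8.3 pp. 122–124] [cite: DeitmarEchterhoff2014, Cor. 1.5.4; Lemma 9.3.3] -/
theorem integrable_prod_pi_group_quotient_isolate_of_forall_not_mem (hα : ∀ i, α i ≠ 0) (hS' : ∀ w, w ∈ S' → w ∈ splitChartPlaces L α)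
    (hp : ∀ w, p w → w ∉ S')
    {c : {w : InfinitePlace L // IsComplex w} → Fin 3 → ℝ} (hc : c ∈ ArchCartan.RegG S')
    {a' : ↥(arch (↥(maximalRealSubfield L)) L (IsCMField.complexConj L) 3 (Matrix.diagonal α)) → ℂ} (ha'c : Continuous a') (ha's : HasCompactSupport a') :
    Integrable (fun q : (∀ w : {w : {w : InfinitePlace L // IsComplex w} // p w}, ↥(archLocal L 3 (Matrix.diagonal α) w.1)) ×
        (∀ w' : {w : {w : InfinitePlace L // IsComplex w} // ¬ p w}, ↥(archLocal L 3 (Matrix.diagonal α) w'.1) ⧸ chartTorusGLoc L α w'.1 S') =>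
        a' ((archPiEquivCM 3 L (Matrix.diagonal α)).symm
          ((MeasurableEquiv.piEquivPiSubtypeProd (fun w : {w : InfinitePlace L // IsComplex w} => ↥(archLocal L 3 (Matrix.diagonal α) w)) p).symm
            (fun w => q.1 w * gprimeBlockAt L α w.1 S' (c w.1) * (q.1 w)⁻¹,
              fun w' => descConj (gprimeBlockAt L α w'.1 S' (c w'.1)) (chartTorusGLoc L α w'.1 S') (forall_mem_chartTorusGLoc_comm L α w'.1 S' (c w'.1)) id (q.2 w')))))
      ((Measure.pi fun w : {w : {w : InfinitePlace L // IsComplex w} // p w} => ν'w w.1).prod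
        (Measure.pi fun w' : {w : {w : InfinitePlace L // IsComplex w} // ¬ p w} =>
          quotientMeasure (chartTorusGLoc L α w'.1 S') (t w'.1) (isClosed_chartTorusGLoc L α w'.1 S') (ν'w w'.1))) := by
  haveI : ∀ w : {w : InfinitePlace L // IsComplex w}, IsClosed (chartTorusGLoc L α w S' : Set ↥(archLocal L 3 (Matrix.diagonal α) w)) :=
    fun w => isClosed_chartTorusGLoc L α w S'
  haveI : ∀ w : {w : InfinitePlace L // IsComplex w}, SecondCountableTopology (↥(archLocal L 3 (Matrix.diagonal α) w) ⧸ chartTorusGLoc L α w S') := fun w => inferInstance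
  haveI : ∀ w : {w : InfinitePlace L // IsComplex w},
      SigmaFinite (quotientMeasure (chartTorusGLoc L α w S') (t w) (isClosed_chartTorusGLoc L α w S') (ν'w w)) := fun w => inferInstance
  haveI : ∀ w, LocallyCompactSpace ↥(chartTorusGLoc L α w S') := fun w => locallyCompactSpace_chartTorusGLoc L α w S'
  haveI : ∀ w, SecondCountableTopology ↥(chartTorusGLoc L α w S') := fun w => TopologicalSpace.Subtype.secondCountableTopology _
  haveI : ∀ w, SigmaFinite (t w) := fun w => inferInstance
  haveI : ∀ w : {w : InfinitePlace L // IsComplex w}, SigmaFinite (ν'w w) := fun w => inferInstance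
  haveI : ∀ w : {w : {w : InfinitePlace L // IsComplex w} // p w}, CompactSpace ↥(chartTorusGLoc L α w.1 S') :=
    fun w => compactSpace_chartTorusGLoc_of_not_mem L α w.1 S' hα hS' (hp w.1 w.2)
  -- (1) ★ (A1): the all-places quotient integrand is integrable; split the index set (★ (A1) §0, measure preserving) and reassemble through `descConj … id` (★ :242 §2)
  have hint := integrable_comp_symm_archPiEquivCM_descConj_pi_of_regG L α S' ν'w ν' hν t hα hS' hc ha'c ha's
  have hψ' := (measurePreserving_piEquivPiSubtypeProd'
    (fun w : {w : InfinitePlace L // IsComplex w} => quotientMeasure (chartTorusGLoc L α w S') (t w) (isClosed_chartTorusGLoc L α w S') (ν'w w)) p).symm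
    (MeasurableEquiv.piEquivPiSubtypeProd
      (fun w : {w : InfinitePlace L // IsComplex w} => ↥(archLocal L 3 (Matrix.diagonal α) w) ⧸ chartTorusGLoc L α w S') p)
  have hFyb : Integrable (fun q : (∀ w : {w : {w : InfinitePlace L // IsComplex w} // p w}, ↥(archLocal L 3 (Matrix.diagonal α) w.1) ⧸ chartTorusGLoc L α w.1 S') ×
        (∀ w' : {w : {w : InfinitePlace L // IsComplex w} // ¬ p w}, ↥(archLocal L 3 (Matrix.diagonal α) w'.1) ⧸ chartTorusGLoc L α w'.1 S') =>
        a' ((archPiEquivCM 3 L (Matrix.diagonal α)).symm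
          ((MeasurableEquiv.piEquivPiSubtypeProd (fun w : {w : InfinitePlace L // IsComplex w} => ↥(archLocal L 3 (Matrix.diagonal α) w)) p).symm
            (fun w => descConj (gprimeBlockAt L α w.1 S' (c w.1)) (chartTorusGLoc L α w.1 S') (forall_mem_chartTorusGLoc_comm L α w.1 S' (c w.1)) id (q.1 w),
              fun w' => descConj (gprimeBlockAt L α w'.1 S' (c w'.1)) (chartTorusGLoc L α w'.1 S') (forall_mem_chartTorusGLoc_comm L α w'.1 S' (c w'.1)) id (q.2 w')))))
      ((Measure.pi fun w : {w : {w : InfinitePlace L // IsComplex w} // p w} =>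
          quotientMeasure (chartTorusGLoc L α w.1 S') (t w.1) (isClosed_chartTorusGLoc L α w.1 S') (ν'w w.1)).prod
        (Measure.pi fun w' : {w : {w : InfinitePlace L // IsComplex w} // ¬ p w} =>
          quotientMeasure (chartTorusGLoc L α w'.1 S') (t w'.1) (isClosed_chartTorusGLoc L α w'.1 S') (ν'w w'.1))) := by
    refine ((hψ'.integrable_comp_emb (MeasurableEquiv.measurableEmbedding _)).mpr hint).congr (Filter.Eventually.of_forall fun q => ?_)
    obtain ⟨y, b⟩ := q
    simp only [Function.comp_apply]
    rw [descConj_assembleQuotient_pred_eq L α S' p c y b]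
  -- (2) the product of the quotient maps on the `p`-block: Borel, image measure `(Π_p t_w(T′_w)) • ⊗_p (ν′_w ∕ t_w)` (compact `T′_w`, §0)
  have hmass : ∀ w : {w : {w : InfinitePlace L // IsComplex w} // p w}, t w.1 Set.univ ≠ ∞ := fun w => (isCompact_univ.measure_lt_top).ne
  have hmk := measurable_pi_quotientMk (fun w : {w : {w : InfinitePlace L // IsComplex w} // p w} => chartTorusGLoc L α w.1 S')
  have hmap := map_pi_quotientMk_eq_prod_smul_pi_quotientMeasure (fun w : {w : {w : InfinitePlace L // IsComplex w} // p w} => chartTorusGLoc L α w.1 S')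
    (fun w => isClosed_chartTorusGLoc L α w.1 S') (fun w => t w.1) (fun w => ν'w w.1)
  -- (3) transport the integrability along `Prod.map (π_p) id` (its image of `(⊗_p ν′_w) ⊗ (⊗_{¬p} ν′_w ∕ t_w)` is `(Π_p t_w(T′_w)) • ((⊗_p ν′_w ∕ t_w) ⊗ (⊗_{¬p} ν′_w ∕ t_w))`)
  have hmapθ := Measure.map_prod_map (Measure.pi fun w : {w : {w : InfinitePlace L // IsComplex w} // p w} => ν'w w.1)
    (Measure.pi fun w' : {w : {w : InfinitePlace L // IsComplex w} // ¬ p w} =>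
      quotientMeasure (chartTorusGLoc L α w'.1 S') (t w'.1) (isClosed_chartTorusGLoc L α w'.1 S') (ν'w w'.1)) hmk measurable_id
  rw [Measure.map_id, hmap, Measure.prod_smul_left] at hmapθ
  have hFyb' := hFyb.smul_measure (c := ∏ w : {w : {w : InfinitePlace L // IsComplex w} // p w}, t w.1 Set.univ)
    (ENNReal.prod_ne_top fun w _ => hmass w)
  rw [hmapθ] at hFyb'
  -- (4) the composite with `Prod.map (π_p) id` IS the two-block integrand (`descConj … id (g T′) = g γ g⁻¹`, definitional)
  refine ((integrable_map_measure hFyb'.aestronglyMeasurable (hmk.prodMap measurable_id).aemeasurable).1 hFyb').congr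
    (Filter.Eventually.of_forall fun q => ?_)
  simp only [Function.comp_apply, Prod.map_fst, Prod.map_snd, id_eq, descConj_mk]

include hν in
/-- **(J-iso)^T, GROUP FORM AT COMPACT PLACES — ORDER SWAPPED: the `p`-block `U(3)`-average INSIDE the `¬p`-quotient integral.**  For admissible `S′`, a block `p` of COMPACT-chart
places (`p w → w ∉ S′`), `c ∈ RegG S′` and `a′ ∈ C_c(G′_∞)`:
`chartOrbG ν′ S′ a′ c = (Π_{¬p} t_w(B′_w)) · ∫_{ḃ ∈ Π_{¬p} (U_w ⧸ T′_w)} ( ∫_{g ∈ Π_{p} U(α)_w} a′ (e⁻¹ ((g_w γ_w(c) g_w⁻¹)_{p}, (ḃ_w γ_w(c) ḃ_w⁻¹)_{¬p})) d(⊗_{p} ν′_w) ) d(⊗_{¬p} ν′_w ∕ t_w)`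
(★ :242 `chartOrbG_eq_prod_mul_integral_pi_group_isolate_of_forall_not_mem` + Mathlib `integral_integral_swap` on `integrable_prod_pi_group_quotient_isolate_of_forall_not_mem`).
[cite: Folland1995, §2.2; §2.6 Thm. 2.49, (2.52)] [cite: Rogawski1990, §8.2 p. 122; §8.3 p. 124] [cite: DeitmarEchterhoff2014, Cor. 1.5.4; Lemma 9.3.3] [cite: BorelJacquet1979, §4.1] -/
theorem chartOrbG_eq_prod_mul_integral_quotient_integral_group_isolate_of_forall_not_mem (hα : ∀ i, α i ≠ 0)
    (hS' : ∀ w, w ∈ S' → w ∈ splitChartPlaces L α) (hp : ∀ w, p w → w ∉ S')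
    {c : {w : InfinitePlace L // IsComplex w} → Fin 3 → ℝ} (hc : c ∈ ArchCartan.RegG S')
    {a' : ↥(arch (↥(maximalRealSubfield L)) L (IsCMField.complexConj L) 3 (Matrix.diagonal α)) → ℂ} (ha'c : Continuous a') (ha's : HasCompactSupport a') :
    chartOrbG L α ν' S' a' c =
      (∏ w' : {w : {w : InfinitePlace L // IsComplex w} // ¬ p w}, ((t w'.1 (chartBoxImgGLoc L α w'.1 S')).toReal : ℂ)) *
        ∫ b : (∀ w' : {w : {w : InfinitePlace L // IsComplex w} // ¬ p w}, ↥(archLocal L 3 (Matrix.diagonal α) w'.1) ⧸ chartTorusGLoc L α w'.1 S'),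
          (∫ g : (∀ w : {w : {w : InfinitePlace L // IsComplex w} // p w}, ↥(archLocal L 3 (Matrix.diagonal α) w.1)),
            a' ((archPiEquivCM 3 L (Matrix.diagonal α)).symm
              ((MeasurableEquiv.piEquivPiSubtypeProd (fun w : {w : InfinitePlace L // IsComplex w} => ↥(archLocal L 3 (Matrix.diagonal α) w)) p).symm
                (fun w => g w * gprimeBlockAt L α w.1 S' (c w.1) * (g w)⁻¹,
                  fun w' => descConj (gprimeBlockAt L α w'.1 S' (c w'.1)) (chartTorusGLoc L α w'.1 S') (forall_mem_chartTorusGLoc_comm L α w'.1 S' (c w'.1)) id (b w'))))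
            ∂(Measure.pi fun w : {w : {w : InfinitePlace L // IsComplex w} // p w} => ν'w w.1))
          ∂(Measure.pi fun w' : {w : {w : InfinitePlace L // IsComplex w} // ¬ p w} =>
              quotientMeasure (chartTorusGLoc L α w'.1 S') (t w'.1) (isClosed_chartTorusGLoc L α w'.1 S') (ν'w w'.1)) := by
  rw [chartOrbG_eq_prod_mul_integral_pi_group_isolate_of_forall_not_mem L α S' ν'w ν' hν t p hα hS' hp hc ha'c ha's]
  congr 1
  exact integral_integral_swap (integrable_prod_pi_group_quotient_isolate_of_forall_not_mem L α S' ν'w ν' hν t p hα hS' hp hc ha'c ha's)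

end IsolateSwap

end Literature.NumberTheory.Automorphic.UnitaryGroup

namespace Literature.NumberTheory.Rogawski1990

section DefiniteClosedFormSwap

variable (L : Type) [Field L] [NumberField L] [IsCMField L] (α : Fin 3 → L) (S' : Finset {w : InfinitePlace L // IsComplex w})
  [∀ w : {w : InfinitePlace L // IsComplex w}, MeasurableSpace ↥(archLocal L 3 (Matrix.diagonal α) w)]
  [∀ w : {w : InfinitePlace L // IsComplex w}, BorelSpace ↥(archLocal L 3 (Matrix.diagonal α) w)]
  [∀ w : {w : InfinitePlace L // IsComplex w}, LocallyCompactSpace ↥(archLocal L 3 (Matrix.diagonal α) w)]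
  [∀ w : {w : InfinitePlace L // IsComplex w}, SecondCountableTopology ↥(archLocal L 3 (Matrix.diagonal α) w)]
  [MeasurableSpace ↥(arch (↥(maximalRealSubfield L)) L (IsCMField.complexConj L) 3 (Matrix.diagonal α))]
  [BorelSpace ↥(arch (↥(maximalRealSubfield L)) L (IsCMField.complexConj L) 3 (Matrix.diagonal α))]
  [∀ w : {w : InfinitePlace L // IsComplex w}, MeasurableSpace (↥(archLocal L 3 (Matrix.diagonal α) w) ⧸ chartTorusGLoc L α w S')]
  [∀ w : {w : InfinitePlace L // IsComplex w}, BorelSpace (↥(archLocal L 3 (Matrix.diagonal α) w) ⧸ chartTorusGLoc L α w S')]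
  (ν'w : ∀ w : {w : InfinitePlace L // IsComplex w}, Measure ↥(archLocal L 3 (Matrix.diagonal α) w)) [∀ w, (ν'w w).IsHaarMeasure] [∀ w, (ν'w w).IsMulRightInvariant]
  (ν' : Measure ↥(arch (↥(maximalRealSubfield L)) L (IsCMField.complexConj L) 3 (Matrix.diagonal α))) [ν'.IsHaarMeasure] [ν'.IsMulRightInvariant]
  (hν : ν' = (Measure.pi ν'w).map (archPiEquivCM 3 L (Matrix.diagonal α)).symm)
  (t : ∀ w : {w : InfinitePlace L // IsComplex w}, Measure ↥(chartTorusGLoc L α w S')) [∀ w, (t w).IsHaarMeasure] [∀ w, (t w).IsInvInvariant]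
  (p : {w : InfinitePlace L // IsComplex w} → Prop) [DecidablePred p]
  [Fintype {w : {w : InfinitePlace L // IsComplex w} // p w}] [Fintype {w : {w : InfinitePlace L // IsComplex w} // ¬ p w}]

set_option maxHeartbeats 2000000 in
include hν in
/-- **THE `α`-SIDE PARTNER SUM IN CLOSED FORM, `U(3)^D`-AVERAGE INSIDE** (E2b with the Fubini swap of §1 in every partner term): for an admissible `S′`, a block `p` of `α`-DEFINITE
places (`p w → w ∉ splitChartPlaces L α`), `c ∈ RegG S′`, `a′ ∈ C_c(G′_∞)`, product-measure convention `hν` and any inversion-invariant Haar family `t_w` on the local chart tori: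
`Σ_{ρ ∈ partnerPerms S′} chartOrbG ν′ S′ a′ (ρ·c) = 6^{#p} · Σ_{ρ₂ ∈ partnerPerms S′|_{¬p}} (Π_{¬p} t_w(B′_w)) · ∫_{Π_{¬p} (U_w ⧸ T′_w)} ∫_{Π_p U(α)_w} a′ (e⁻¹ ((g γ_w(ρ′c) g⁻¹)_p, (ḃ γ_w(ρ′c) ḃ⁻¹)_{¬p}))`,
`ρ′ = 1 ⊔ ρ₂` — E2a's `6^{#D}` collapse (★ `sum_partnerPerms_chartOrbG_eq_card_mul_sum_restrict`) then §1 at each regular partner point (★ `slotPerm_mem_regG_iff`; the glued relabelling `1 ⊔ ρ₂` is a partner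
relabelling, as in E2b `piEquivPiSubtypeProd_symm_one_mem_partnerPerms`).  The inner integral is the `U(3)^D`-average `Ā_{a′}((γ_w(c))_{p}, ·)` of CENSUS E3 §2 read at `(ḃ γ_w(ρ′c) ḃ⁻¹)_{¬p}`.
[cite: Rogawski1990, §4.1 (4.1.1) p. 39; §8.2 p. 122; §8.3 p. 124] [cite: Folland1995, §2.6 (2.52)] [cite: Shelstad1979, Lemma 4.2 p. 23] [cite: BorelJacquet1979, §4.1] -/
theorem sum_partnerPerms_chartOrbG_eq_card_mul_sum_integral_quotient_integral_group (hα : ∀ i, α i ≠ 0)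
    (hherm : ∀ i, (IsCMField.complexConj L (α i) : L) = α i)
    (hS' : ∀ w, w ∈ S' → w ∈ splitChartPlaces L α) (hp : ∀ w, p w → w ∉ splitChartPlaces L α)
    {c : {w : InfinitePlace L // IsComplex w} → Fin 3 → ℝ} (hc : c ∈ ArchCartan.RegG S')
    {a' : ↥(arch (↥(maximalRealSubfield L)) L (IsCMField.complexConj L) 3 (Matrix.diagonal α)) → ℂ} (ha'c : Continuous a') (ha's : HasCompactSupport a') :
    ∑ ρ ∈ partnerPerms S', chartOrbG L α ν' S' a' (slotPerm ρ c) =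
      (6 : ℂ) ^ Fintype.card {w : {w : InfinitePlace L // IsComplex w} // p w} *
        ∑ ρ₂ ∈ partnerPerms (S'.subtype fun w => ¬ p w),
          (∏ w' : {w : {w : InfinitePlace L // IsComplex w} // ¬ p w}, ((t w'.1 (chartBoxImgGLoc L α w'.1 S')).toReal : ℂ)) *
            ∫ b : (∀ w' : {w : {w : InfinitePlace L // IsComplex w} // ¬ p w}, ↥(archLocal L 3 (Matrix.diagonal α) w'.1) ⧸ chartTorusGLoc L α w'.1 S'),
              (∫ g : (∀ w : {w : {w : InfinitePlace L // IsComplex w} // p w}, ↥(archLocal L 3 (Matrix.diagonal α) w.1)),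
                a' ((archPiEquivCM 3 L (Matrix.diagonal α)).symm
                  ((MeasurableEquiv.piEquivPiSubtypeProd (fun w : {w : InfinitePlace L // IsComplex w} => ↥(archLocal L 3 (Matrix.diagonal α) w)) p).symm
                    (fun w => g w * gprimeBlockAt L α w.1 S'
                        (slotPerm ((Equiv.piEquivPiSubtypeProd p (fun _ : {w : InfinitePlace L // IsComplex w} => Equiv.Perm (Fin 3))).symm (1, ρ₂)) c w.1) * (g w)⁻¹,
                      fun w' => descConj (gprimeBlockAt L α w'.1 S'
                          (slotPerm ((Equiv.piEquivPiSubtypeProd p (fun _ : {w : InfinitePlace L // IsComplex w} => Equiv.Perm (Fin 3))).symm (1, ρ₂)) c w'.1))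
                        (chartTorusGLoc L α w'.1 S')
                        (forall_mem_chartTorusGLoc_comm L α w'.1 S'
                          (slotPerm ((Equiv.piEquivPiSubtypeProd p (fun _ : {w : InfinitePlace L // IsComplex w} => Equiv.Perm (Fin 3))).symm (1, ρ₂)) c w'.1))
                        id (b w'))))
                ∂(Measure.pi fun w : {w : {w : InfinitePlace L // IsComplex w} // p w} => ν'w w.1))
              ∂(Measure.pi fun w' : {w : {w : InfinitePlace L // IsComplex w} // ¬ p w} =>
                  quotientMeasure (chartTorusGLoc L α w'.1 S') (t w'.1) (isClosed_chartTorusGLoc L α w'.1 S') (ν'w w'.1)) := by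
  have hpS : ∀ w, p w → w ∉ S' := fun w hw h => hp w hw (hS' w h)
  -- E2a is stated with the INFERRED subtype `Fintype` instances; substitute this theorem's explicit binders by them first (`Fintype _` is a subsingleton)
  obtain rfl : ‹Fintype {w : {w : InfinitePlace L // IsComplex w} // p w}› = Subtype.fintype _ := Subsingleton.elim _ _
  obtain rfl : ‹Fintype {w : {w : InfinitePlace L // IsComplex w} // ¬ p w}› = Subtype.fintype _ := Subsingleton.elim _ _
  rw [sum_partnerPerms_chartOrbG_eq_card_mul_sum_restrict L α ν' S' p hα hherm hS' hp a' c]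
  congr 1
  refine Finset.sum_congr rfl fun ρ₂ hρ₂ => ?_
  have hρ : (Equiv.piEquivPiSubtypeProd p (fun _ : {w : InfinitePlace L // IsComplex w} => Equiv.Perm (Fin 3))).symm (1, ρ₂) ∈ partnerPerms S' := by
    refine (mem_partnerPerms_iff S' _).2 fun w hw => ?_
    rw [Equiv.piEquivPiSubtypeProd_symm_apply]
    by_cases hpw : p w
    · exact absurd hw (hpS w hpw)
    · rw [dif_neg hpw]
      exact (mem_partnerPerms_iff _ _).1 hρ₂ ⟨w, hpw⟩ (Finset.mem_subtype.2 hw)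
  exact chartOrbG_eq_prod_mul_integral_quotient_integral_group_isolate_of_forall_not_mem L α S' ν'w ν' hν t p hα hS' hpS
    ((slotPerm_mem_regG_iff hρ c).2 hc) ha'c ha's

end DefiniteClosedFormSwap

end Literature.NumberTheory.Rogawski1990

end
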